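import Literature.NumberTheory.ComplexMultiplication.FiniteQAlgebraLatticeMetricDual
import HarnessLib

/-!
# Hertling–Larabi 2026b COROLLARY 4.15: in a 2-dimensional commutative `ℚ`-algebra EVERY full lattice is invertible —
# and the lemma of its third proof, «each order in `A` is cyclic», for an ARBITRARY 2-dimensional `A`
# (`ℚ(√d)`, `ℚ ⊕ ℚ`, `ℚ[x]/(x²)`)

[topic NumberTheory/ComplexMultiplication] General-`A` series (namespace
`Literature.NumberTheory.ComplexMultiplication.FiniteQAlgebraLattice`), sequel of `FiniteQAlgebraLatticeMetricDual`
(HL26b Thm. 4.12: over a cyclic order `ℤ[a]` every full lattice `L` with `𝒪(L) = ℤ[a]` is invertible) and of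
`FiniteQAlgebraLatticePowersInvertible` (HL26b Thm. 4.4 = HL 2026 Thm. 10.1: `L^k` is invertible for `k ≥ dim A − 1`).
Lane `lit-hodgefound` (Track 2 foundations library), seat p19 generation 36, row g36-#2.  THEOREMS ONLY: no definition, no
instance, no notation, no named fact (D-0026, net Literature debt `0`), no `sorry`.

## Source, VERBATIM

C. Hertling, K. Larabi, *Conjugacy classes of regular integer matrices*, arXiv:2602.15748 (2026) [HertlingLarabi2026b],
held `paper:arxiv-2602.15748`, §4 (chunk p0008): «The case `dim A = 2` is special and famous. In that case each full
lattice is invertible. We can offer now four different proofs of this fact, three by results which are cited in this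
section, the fourth one consists of direct proofs for the different cases. **Corollary 4.15.** Let `dim A = 2`. Then
each full lattice `L` is invertible. Four proofs: (1) Apply Theorem 4.4. (2) There is an `ω ∈ Λ_max` with
`Λ_max = ℤ1_A + ℤω`. Therefore `Λ_max = Λ + Λω` for each order `Λ` in `A`. Apply Theorem 4.9. (3) Each order in `A` is
cyclic. Apply Theorem 4.12. (4) For `A` an algebraic number field, the corollary is also proved in [DTZ62]. For
`A = ℚe_1 ⊕ ℚe_2` it is part of Theorem 9.1 (d). For `A ≅ ℚ[x]/(x²)` it is part of Theorem 10.3 (b). □»; §4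
(chunk p0007): «**Definition 4.1.** […] (b) An order in `A` is a full lattice `Λ` in `A` with `1_A ∈ Λ` and
`Λ·Λ ⊂ Λ`»; (chunk p0008) «**Definition 4.10.** (a) An order `Λ` in `A` is cyclic if an `a ∈ Λ` with `Λ = ℤ[a]`
exists.»

## What is formalised (`Λ`, `M : Submodule ℤ A`; an order is `1 ∈ Λ`, `ΛΛ ⊆ Λ`, `IsFullLattice A Λ`)

* §1 `ℚ·1_A ∩ Λ = ℤ·1_A` for every order `Λ` of any `A ≠ 0` (`smul_one_mem_iff_of_one_mem`): a rational multiple of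
  `1_A` lying in a finitely generated subring is integral over `ℤ`, and `ℤ` is integrally closed.
* §2 PROOF (3)'s LEMMA «each order in `A` is cyclic» for `dim A = 2`: **`exists_adjoin_toSubmodule_eq_of_finrank_eq_two`**
  — on a `ℤ`-basis `b_0, b_1` of `Λ`, `1_A = pb_0 + qb_1` with `gcd(p, q) = 1` by §1, and Bézout's `pr + qs = 1`
  completes `1_A` to the basis `1_A, ω = −sb_0 + rb_1`, so `Λ = ℤ1_A ⊕ ℤω = ℤ[ω]`; hence `A = ℚ[ω]` is cyclic
  (`exists_adjoin_eq_top_of_finrank_eq_two`, via Lemma 4.11 (a) (i)).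
* §3 COROLLARY 4.15 by proof (1): `dim A ≤ 2 ⟹ L·(𝒪(L):L) = 𝒪(L)` for every full `L`
  (**`mul_div_div_eq_of_finrank_le_two`**, the case `k = 1` of `pow_mul_div_div_eq_of_isFullLattice`), and by proof
  (3) in the order form: for every order `Λ` of a 2-dimensional `A` and every full `L` with `𝒪(L) = Λ`,
  `L·(Λ:L) = Λ` (`mul_div_eq_of_finrank_eq_two`, Theorem 4.12 applied to `Λ = ℤ[ω]`).
NOT here: proofs (2) (Theorem 4.9, BF65) and (4).

## References
* [HertlingLarabi2026b] C. Hertling, K. Larabi, arXiv:2602.15748 (2026), §4 Def. 4.1 (b), Def. 4.10 (a), Thm. 4.12,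
  Cor. 4.15 with its «Four proofs» (chunks p0007–p0008). [cite: HertlingLarabi2026b, §4 Cor. 4.15, chunk p0008]
* [DadeTausskyZassenhaus1962] E. C. Dade, O. Taussky, H. Zassenhaus, Math. Ann. 148 (1962) 31–64 (the number-field
  case of Cor. 4.15, as cited). [cite: DadeTausskyZassenhaus1962, as cited by HertlingLarabi2026b Cor. 4.15 (4)]
-/

noncomputable section

open scoped Classical Pointwise
open Submodule Module
open Literature.NumberTheory.Automorphic (IsFullLattice isFullLattice_span_of_basis)

namespace Literature.NumberTheory.ComplexMultiplication.FiniteQAlgebraLattice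

variable {A : Type} [CommRing A] [Algebra ℚ A]

/-! ## §1 The rational multiples of `1_A` inside an order -/

/-- **`ℚ·1_A ∩ Λ = ℤ·1_A` for an order `Λ`** (`1_A ∈ Λ`, `ΛΛ ⊆ Λ`, `Λ` finitely generated; `A ≠ 0`): `q·1_A ∈ Λ` iff
`q ∈ ℤ` — an element of a finitely generated subring is integral over `ℤ`, `ℚ → A` is injective, and `ℤ` is integrally
closed («An order in `A` is a full lattice `Λ` in `A` with `1_A ∈ Λ` and `Λ·Λ ⊂ Λ`, so it is […] a subring of `A`»).
[cite: HertlingLarabi2026b, §4 Def. 4.1 (b), chunk p0007] -/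
theorem smul_one_mem_iff_of_one_mem [Nontrivial A] {Λ : Submodule ℤ A} (hfg : Λ.FG) (h1 : (1 : A) ∈ Λ)
    (hΛΛ : Λ * Λ ≤ Λ) (q : ℚ) : q • (1 : A) ∈ Λ ↔ ∃ z : ℤ, (z : ℚ) = q := by
  constructor
  · intro hq
    -- `Λ` as a `ℤ`-subalgebra
    let S : Subalgebra ℤ A :=
      { carrier := Λ
        mul_mem' := fun ha hb => hΛΛ (Submodule.mul_mem_mul ha hb)
        one_mem' := h1
        add_mem' := fun ha hb => Λ.add_mem ha hb
        zero_mem' := Λ.zero_mem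
        algebraMap_mem' := fun k => by
          rw [Algebra.algebraMap_eq_smul_one]
          exact Λ.smul_mem k h1 }
    have hS : (Subalgebra.toSubmodule S).FG := hfg
    have hint : IsIntegral ℤ (algebraMap ℚ A q) := by
      rw [Algebra.algebraMap_eq_smul_one]
      exact IsIntegral.of_mem_of_fg S hS _ hq
    rw [isIntegral_algebraMap_iff (algebraMap ℚ A).injective] at hint
    obtain ⟨z, hz⟩ := (IsIntegrallyClosed.isIntegral_iff (R := ℤ) (K := ℚ)).1 hint
    exact ⟨z, by rw [← hz, eq_intCast]⟩
  · rintro ⟨z, rfl⟩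
    rw [Int.cast_smul_eq_zsmul]
    exact Λ.smul_mem z h1

/-! ## §2 Each order of a 2-dimensional algebra is cyclic (the lemma of proof (3)) -/

variable [Module.Finite ℚ A]

omit [Module.Finite ℚ A] in
/-- **«EACH ORDER IN `A` IS CYCLIC» for `dim A = 2`: every order `Λ` is `ℤ[ω] = ℤ1_A ⊕ ℤω` for some `ω ∈ Λ`** — on a
`ℤ`-basis `b_0, b_1` of `Λ` write `1_A = pb_0 + qb_1`; `gcd(p, q) = 1` because `gcd⁻¹·1_A ∈ Λ` forces `gcd = 1`
(`ℚ1_A ∩ Λ = ℤ1_A`); with Bézout's `pr + qs = 1` the element `ω = −sb_0 + rb_1` satisfies `b_0 = r·1_A − qω`,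
`b_1 = s·1_A + pω`, so `Λ = ℤ1_A + ℤω = ℤ[ω]`. [cite: HertlingLarabi2026b, §4 Cor. 4.15 proof (3) with Def. 4.10 (a), chunk p0008] -/
theorem exists_adjoin_toSubmodule_eq_of_finrank_eq_two (h2 : finrank ℚ A = 2) {Λ : Submodule ℤ A}
    (hΛ : IsFullLattice A Λ) (h1 : (1 : A) ∈ Λ) (hΛΛ : Λ * Λ ≤ Λ) :
    ∃ ω ∈ Λ, Subalgebra.toSubmodule (Algebra.adjoin ℤ {ω}) = Λ := by
  haveI : Nontrivial A := Module.nontrivial_of_finrank_pos (R := ℚ) (by omega)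
  -- a `ℤ`-basis `b_0, b_1` of `Λ`
  obtain ⟨m, hm⟩ := exists_basis_fin_span_eq hΛ
  let b : Basis (Fin 2) ℚ A := m.reindex (finCongr h2)
  have hb : span ℤ (Set.range b) = Λ := by rw [← hm, Basis.range_reindex]
  -- `1 = p b_0 + q b_1` with `p, q ∈ ℤ`
  have h1b : (1 : A) ∈ span ℤ (Set.range b) := by rw [hb]; exact h1
  have hcoord := (Basis.mem_span_iff_repr_mem ℤ b 1).1 h1b
  obtain ⟨p, hp⟩ := hcoord 0
  obtain ⟨q, hq⟩ := hcoord 1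
  have hone : (1 : A) = p • b 0 + q • b 1 := by
    conv_lhs => rw [← b.sum_repr 1, Fin.sum_univ_two]
    rw [← Int.cast_smul_eq_zsmul ℚ p, ← Int.cast_smul_eq_zsmul ℚ q]
    simp only [eq_intCast] at hp hq
    rw [hp, hq]
  -- `gcd(p, q) = 1`
  obtain ⟨g, hg⟩ : ∃ g : ℤ, (Int.gcd p q : ℤ) = g := ⟨_, rfl⟩
  have hg0 : 0 ≤ g := by rw [← hg]; exact Int.natCast_nonneg _
  have hg1 : g = 1 := by
    have hd0 : g ≠ 0 := by
      intro h0
      rw [h0, Nat.cast_eq_zero, Int.gcd_eq_zero_iff] at hg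
      rw [hg.1, hg.2, zero_smul, zero_smul, add_zero] at hone
      exact one_ne_zero hone
    obtain ⟨p', hp'⟩ := Int.gcd_dvd_left p q
    obtain ⟨q', hq'⟩ := Int.gcd_dvd_right p q
    rw [hg] at hp' hq'
    -- `g⁻¹ · 1_A = p' b_0 + q' b_1 ∈ Λ`
    have hd : (g : ℚ) ≠ 0 := by exact_mod_cast hd0
    have hmem : (g : ℚ)⁻¹ • (1 : A) ∈ Λ := by
      have e : (g : ℚ)⁻¹ • (1 : A) = p' • b 0 + q' • b 1 := by
        rw [hone, hp', hq', smul_add, ← Int.cast_smul_eq_zsmul ℚ (g * p'), ← Int.cast_smul_eq_zsmul ℚ (g * q'),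
          smul_smul, smul_smul, ← Int.cast_smul_eq_zsmul ℚ p', ← Int.cast_smul_eq_zsmul ℚ q', Int.cast_mul,
          Int.cast_mul, ← mul_assoc, ← mul_assoc, inv_mul_cancel₀ hd, one_mul, one_mul]
      rw [e, ← hb]
      exact Submodule.add_mem _ (Submodule.smul_mem _ _ (Submodule.subset_span (Set.mem_range_self _)))
        (Submodule.smul_mem _ _ (Submodule.subset_span (Set.mem_range_self _)))
    obtain ⟨z, hz⟩ := (smul_one_mem_iff_of_one_mem hΛ.1 h1 hΛΛ _).1 hmem
    have hz1 : z * g = 1 := by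
      have h : (z : ℚ) * (g : ℚ) = 1 := by rw [hz, inv_mul_cancel₀ hd]
      exact_mod_cast h
    exact Int.eq_one_of_mul_eq_one_left hg0 hz1
  -- Bézout: `p r + q s = 1`; `ω := -s b_0 + r b_1`
  have hbez : p * Int.gcdA p q + q * Int.gcdB p q = 1 := by
    rw [← Int.gcd_eq_gcd_ab, hg, hg1]
  -- `b_0 = r·1 − qω`, `b_1 = s·1 + pω`
  have hb0 : b 0 = Int.gcdA p q • (1 : A) - q • ((-Int.gcdB p q) • b 0 + Int.gcdA p q • b 1) := by
    rw [hone]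
    conv_lhs => rw [← one_smul ℤ (b 0), ← hbez]
    module
  have hb1 : b 1 = Int.gcdB p q • (1 : A) + p • ((-Int.gcdB p q) • b 0 + Int.gcdA p q • b 1) := by
    rw [hone]
    conv_lhs => rw [← one_smul ℤ (b 1), ← hbez]
    module
  have hωΛ : (-Int.gcdB p q) • b 0 + Int.gcdA p q • b 1 ∈ Λ := by
    rw [← hb]
    exact Submodule.add_mem _ (Submodule.smul_mem _ _ (Submodule.subset_span (Set.mem_range_self _)))
      (Submodule.smul_mem _ _ (Submodule.subset_span (Set.mem_range_self _)))
  generalize (-Int.gcdB p q) • b 0 + Int.gcdA p q • b 1 = ω at hb0 hb1 hωΛ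
  refine ⟨ω, hωΛ, ?_⟩
  refine le_antisymm (fun x hx => ?_) ?_
  · -- `ℤ[ω] ⊆ Λ`: `Λ` is a subring containing `ω`
    rw [Subalgebra.mem_toSubmodule] at hx
    refine Algebra.adjoin_induction (fun y hy => ?_) (fun k => ?_) (fun y z _ _ hy hz => Λ.add_mem hy hz)
      (fun y z _ _ hy hz => hΛΛ (Submodule.mul_mem_mul hy hz)) hx
    · rw [Set.mem_singleton_iff] at hy
      rw [hy]
      exact hωΛ
    · rw [Algebra.algebraMap_eq_smul_one]
      exact Λ.smul_mem k h1
  · -- `Λ = ℤb_0 + ℤb_1 ⊆ ℤ1 + ℤω ⊆ ℤ[ω]`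
    have hω : ω ∈ Subalgebra.toSubmodule (Algebra.adjoin ℤ {ω}) := Algebra.self_mem_adjoin_singleton ℤ _
    have h1' : (1 : A) ∈ Subalgebra.toSubmodule (Algebra.adjoin ℤ {ω}) := Subalgebra.one_mem _
    rw [← hb, Submodule.span_le]
    rintro _ ⟨i, rfl⟩
    fin_cases i
    · change b 0 ∈ _
      rw [hb0]
      exact Submodule.sub_mem _ (Submodule.smul_mem _ _ h1') (Submodule.smul_mem _ _ hω)
    · change b 1 ∈ _
      rw [hb1]
      exact Submodule.add_mem _ (Submodule.smul_mem _ _ h1') (Submodule.smul_mem _ _ hω)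

/-- **A 2-dimensional commutative `ℚ`-algebra is cyclic, `A = ℚ[ω]`** — the order `𝒪(L)` of any full lattice is a
cyclic order `ℤ[ω]` (§2), and then `A = ℚ[ω]` by Lemma 4.11 (a) (i).
[cite: HertlingLarabi2026b, §4 Cor. 4.15 proof (3) with Lemma 4.11 (a) (i), chunk p0008] -/
theorem exists_adjoin_eq_top_of_finrank_eq_two (h2 : finrank ℚ A = 2) : ∃ ω : A, Algebra.adjoin ℚ {ω} = ⊤ := by
  -- the order of the full lattice spanned by a basis
  have hL : IsFullLattice A (span ℤ (Set.range (Module.finBasis ℚ A))) := isFullLattice_span_of_basis _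
  have hO : IsFullLattice A (span ℤ (Set.range (Module.finBasis ℚ A)) / span ℤ (Set.range (Module.finBasis ℚ A))) :=
    isFullLattice_div hL hL
  obtain ⟨ω, -, hω⟩ := exists_adjoin_toSubmodule_eq_of_finrank_eq_two h2 hO (one_mem_div_self _)
    (div_self_mul_div_self _).le
  refine ⟨ω, adjoin_eq_top_of_isFullLattice_adjoin ?_⟩
  rw [hω]
  exact hO

/-! ## §3 Corollary 4.15 -/

/-- **COROLLARY 4.15 (proof (1)): if `dim A ≤ 2` then EVERY full lattice `L` of `A` is invertible, `L·(𝒪(L):L) = 𝒪(L)`**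
— «(1) Apply Theorem 4.4»: `L = L^1` and `1 ≥ dim A − 1` (HL 2026 Thm. 10.1 in the tree,
`pow_mul_div_div_eq_of_isFullLattice`). [cite: HertlingLarabi2026b, §4 Cor. 4.15 with proof (1), chunk p0008] -/
theorem mul_div_div_eq_of_finrank_le_two (h2 : finrank ℚ A ≤ 2) {M : Submodule ℤ A} (hM : IsFullLattice A M) :
    M * ((M / M) / M) = M / M := by
  have h := pow_mul_div_div_eq_of_isFullLattice hM (k := 1) (by omega)
  rwa [pow_one] at h

/-- **COROLLARY 4.15 (proof (3)), order form: for every order `Λ` of a 2-dimensional `A`, every full lattice `L` with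
`𝒪(L) = Λ` satisfies `L·(Λ:L) = Λ`** — «(3) Each order in `A` is cyclic. Apply Theorem 4.12»: `Λ = ℤ[ω]` by §2 and
`FiniteQAlgebraLattice.mul_div_eq_of_div_self_eq_adjoin`. [cite: HertlingLarabi2026b, §4 Cor. 4.15 with proof (3) and Thm. 4.12, chunk p0008] -/
theorem mul_div_eq_of_finrank_eq_two (h2 : finrank ℚ A = 2) {Λ : Submodule ℤ A} (hΛ : IsFullLattice A Λ)
    (h1 : (1 : A) ∈ Λ) (hΛΛ : Λ * Λ ≤ Λ) {M : Submodule ℤ A} (hM : IsFullLattice A M) (hO : M / M = Λ) :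
    M * (Λ / M) = Λ := by
  obtain ⟨ω, -, hω⟩ := exists_adjoin_toSubmodule_eq_of_finrank_eq_two h2 hΛ h1 hΛΛ
  subst hω
  exact mul_div_eq_of_div_self_eq_adjoin hΛ hM hO

end Literature.NumberTheory.ComplexMultiplication.FiniteQAlgebraLattice
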